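import Mathlib
import Summits.Ventures.PercRepro2.SwOutCrossGenIterDefs

/-!
# The product of two independent junctions (blind cell PercRepro2, night-4 g24, 2026-08-28;
proofs/NIGHT4-G24.md §13)

Two junctions with disjoint u-arm sets `ι₁`, `ι₂` and fibres `F₁`, `F₂` (each a `FibreIter`, or
anything satisfying the inequality `Ineq`): the product cube has the points `(q₁, q₂)`, the atoms
`AtomG A₁ ι₁ ⊕ AtomG A₂ ι₂`, the leak of either junction, the union of the red atoms, and the
product of the types with the product order.  **`ineq_prodJ`**: the inequality of the product
follows from the inequalities of the two factors — freeze the second junction and apply the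
first inequality on the sliced up-sets (the red atoms of the product are at most the MIXED set
«blue atoms of the first, red atoms of the second»), then freeze the first junction and apply the
second inequality (the mixed set is at most the blue atoms of the product).  This is NOT a
`FibreIter` over `ι₁ ⊕ ι₂` (the leak of a product of junctions is not of the one-junction
form), hence its own cube.
-/

namespace Summit.Ventures.PercRepro2

namespace CrossArm

section Junctions

variable {W₁ A₁ L₁ W₂ A₂ L₂ : Type*} {ι₁ ι₂ : Type*}

/-- A point of the product of two junctions. -/
abbrev PtJ (W₁ ι₁ W₂ ι₂ : Type*) := PtG W₁ ι₁ × PtG W₂ ι₂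

/-- The atoms of the product of two junctions. -/
abbrev AtomJ (A₁ ι₁ A₂ ι₂ : Type*) := AtomG A₁ ι₁ ⊕ AtomG A₂ ι₂

/-- The types of the product of two junctions. -/
abbrev TypJ (L₁ ι₁ L₂ ι₂ : Type*) := TypG L₁ ι₁ × TypG L₂ ι₂

variable (F₁ : FibreIter W₁ A₁ L₁) (F₂ : FibreIter W₂ A₂ L₂)

/-- The leak: either junction leaks. -/
def LeakJ (x : PtJ W₁ ι₁ W₂ ι₂) : Prop := LeakI F₁ x.1 ∨ LeakI F₂ x.2

/-- The red atoms: those of both junctions. -/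
def ERJ (x : PtJ W₁ ι₁ W₂ ι₂) : Set (AtomJ A₁ ι₁ A₂ ι₂) :=
  Sum.inl '' ERI F₁ x.1 ∪ Sum.inr '' ERI F₂ x.2

/-- The blue atoms: those of both junctions. -/
def EBJ (x : PtJ W₁ ι₁ W₂ ι₂) : Set (AtomJ A₁ ι₁ A₂ ι₂) :=
  Sum.inl '' EBI F₁ x.1 ∪ Sum.inr '' EBI F₂ x.2

/-- The mixed set: the blue atoms of the first junction and the red atoms of the second. -/
def EMJ (x : PtJ W₁ ι₁ W₂ ι₂) : Set (AtomJ A₁ ι₁ A₂ ι₂) :=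
  Sum.inl '' EBI F₁ x.1 ∪ Sum.inr '' ERI F₂ x.2

/-- The type of a point. -/
def typJ (x : PtJ W₁ ι₁ W₂ ι₂) : TypJ L₁ ι₁ L₂ ι₂ := (typI F₁ x.1, typI F₂ x.2)

/-- `t'` is at least as good a type as `t`: in both junctions. -/
def BetterJ (t' t : TypJ L₁ ι₁ L₂ ι₂) : Prop := BetterI F₁ t'.1 t.1 ∧ BetterI F₂ t'.2 t.2

/-- An up-set of product types. -/
def IsUpJ (𝒯 : Set (TypJ L₁ ι₁ L₂ ι₂)) : Prop := ∀ t ∈ 𝒯, ∀ t', BetterJ F₁ F₂ t' t → t' ∈ 𝒯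

/-- The slice of an up-set of product types at a type of the second junction. -/
def sliceTJ₁ (𝒯 : Set (TypJ L₁ ι₁ L₂ ι₂)) (t₂ : TypG L₂ ι₂) : Set (TypG L₁ ι₁) := {t₁ | (t₁, t₂) ∈ 𝒯}

/-- The slice of an up-set of product types at a type of the first junction. -/
def sliceTJ₂ (𝒯 : Set (TypJ L₁ ι₁ L₂ ι₂)) (t₁ : TypG L₁ ι₁) : Set (TypG L₂ ι₂) := {t₂ | (t₁, t₂) ∈ 𝒯}

/-- The slice of an up-set of atom sets at an atom set of the second junction. -/
def sliceEJ₁ (𝓔 : Set (Set (AtomJ A₁ ι₁ A₂ ι₂))) (S₂ : Set (AtomG A₂ ι₂)) :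
    Set (Set (AtomG A₁ ι₁)) := {S | Sum.inl '' S ∪ Sum.inr '' S₂ ∈ 𝓔}

/-- The slice of an up-set of atom sets at an atom set of the first junction. -/
def sliceEJ₂ (𝓔 : Set (Set (AtomJ A₁ ι₁ A₂ ι₂))) (S₁ : Set (AtomG A₁ ι₁)) :
    Set (Set (AtomG A₂ ι₂)) := {S | Sum.inl '' S₁ ∪ Sum.inr '' S ∈ 𝓔}

/-- `BetterI` is reflexive. -/
lemma betterI_refl (F : FibreIter W₁ A₁ L₁) (t : TypG L₁ ι₁) : BetterI F t t :=
  ⟨fun _ h => h, F.betterL_refl _⟩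

/-- The slices of an up-set of product types are up-sets. -/
lemma isUpI_sliceTJ₁ {𝒯 : Set (TypJ L₁ ι₁ L₂ ι₂)} (h𝒯 : IsUpJ F₁ F₂ 𝒯) (t₂ : TypG L₂ ι₂) :
    IsUpI F₁ (sliceTJ₁ 𝒯 t₂) :=
  fun _ ht _ hle => h𝒯 _ ht _ ⟨hle, betterI_refl F₂ t₂⟩

/-- The slices of an up-set of product types are up-sets. -/
lemma isUpI_sliceTJ₂ {𝒯 : Set (TypJ L₁ ι₁ L₂ ι₂)} (h𝒯 : IsUpJ F₁ F₂ 𝒯) (t₁ : TypG L₁ ι₁) :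
    IsUpI F₂ (sliceTJ₂ 𝒯 t₁) :=
  fun _ ht _ hle => h𝒯 _ ht _ ⟨betterI_refl F₁ t₁, hle⟩

/-- The slices of an up-set of atom sets are up-sets. -/
lemma isUpperSet_sliceEJ₁ {𝓔 : Set (Set (AtomJ A₁ ι₁ A₂ ι₂))} (h𝓔 : IsUpperSet 𝓔)
    (S₂ : Set (AtomG A₂ ι₂)) : IsUpperSet (sliceEJ₁ 𝓔 S₂) :=
  fun _ _ hle h => h𝓔 (Set.union_subset_union_left _ (Set.image_mono hle)) h

/-- The slices of an up-set of atom sets are up-sets. -/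
lemma isUpperSet_sliceEJ₂ {𝓔 : Set (Set (AtomJ A₁ ι₁ A₂ ι₂))} (h𝓔 : IsUpperSet 𝓔)
    (S₁ : Set (AtomG A₁ ι₁)) : IsUpperSet (sliceEJ₂ 𝓔 S₁) :=
  fun _ _ hle h => h𝓔 (Set.union_subset_union_right _ (Set.image_mono hle)) h

variable [Fintype ι₁] [DecidableEq ι₁] [Fintype W₁] [DecidableEq W₁]
  [Fintype ι₂] [DecidableEq ι₂] [Fintype W₂] [DecidableEq W₂]

open scoped Classical

/-- The non-leaking points whose type lies in `𝒯`. -/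
noncomputable def QJ (𝒯 : Set (TypJ L₁ ι₁ L₂ ι₂)) : Finset (PtJ W₁ ι₁ W₂ ι₂) :=
  Finset.univ.filter fun x => ¬ LeakJ F₁ F₂ x ∧ typJ F₁ F₂ x ∈ 𝒯

omit [DecidableEq W₁] [DecidableEq W₂] in
/-- Membership in `QJ`. -/
lemma mem_QJ {𝒯 : Set (TypJ L₁ ι₁ L₂ ι₂)} {x : PtJ W₁ ι₁ W₂ ι₂} :
    x ∈ QJ F₁ F₂ 𝒯 ↔ ¬ LeakJ F₁ F₂ x ∧ typJ F₁ F₂ x ∈ 𝒯 := by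
  simp only [QJ, Finset.mem_filter, Finset.mem_univ, true_and]

omit [DecidableEq W₁] in
/-- **Step 1, the second junction frozen**: the red count is at most the mixed count. -/
lemma card_red_le_mixedJ (h₁ : Ineq F₁ (ι := ι₁)) {𝒯 : Set (TypJ L₁ ι₁ L₂ ι₂)}
    (h𝒯 : IsUpJ F₁ F₂ 𝒯) {𝓔 : Set (Set (AtomJ A₁ ι₁ A₂ ι₂))} (h𝓔 : IsUpperSet 𝓔)
    (c : PtG W₂ ι₂) :
    ((QJ F₁ F₂ 𝒯).filter fun x => x.2 = c ∧ ERJ F₁ F₂ x ∈ 𝓔).card ≤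
      ((QJ F₁ F₂ 𝒯).filter fun x => x.2 = c ∧ EMJ F₁ F₂ x ∈ 𝓔).card := by
  by_cases hc : LeakI F₂ c
  · -- a leaking second junction: both sides are empty
    have h0 : ∀ P : PtJ W₁ ι₁ W₂ ι₂ → Prop,
        ((QJ F₁ F₂ 𝒯).filter fun x => x.2 = c ∧ P x) = ∅ := by
      intro P
      rw [Finset.filter_eq_empty_iff]
      rintro x hx ⟨hxc, -⟩
      exact ((mem_QJ F₁ F₂).1 hx).1 (Or.inr (hxc ▸ hc))
    rw [h0, h0]
  have key := h₁ _ _ (isUpI_sliceTJ₁ F₁ F₂ h𝒯 (typI F₂ c)) (isUpperSet_sliceEJ₁ h𝓔 (ERI F₂ c))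
  have e1 : ((QJ F₁ F₂ 𝒯).filter fun x => x.2 = c ∧ ERJ F₁ F₂ x ∈ 𝓔).card =
      ((QI F₁ (sliceTJ₁ 𝒯 (typI F₂ c))).filter fun q => ERI F₁ q ∈ sliceEJ₁ 𝓔 (ERI F₂ c)).card := by
    refine Finset.card_bij' (fun x _ => x.1) (fun q _ => (q, c)) ?_ ?_ ?_ ?_
    · intro x hx
      rw [Finset.mem_filter, mem_QJ] at hx
      obtain ⟨⟨hl, ht⟩, hxc, hE⟩ := hx
      rw [Finset.mem_filter, mem_QI]
      refine ⟨⟨fun h => hl (Or.inl h), ?_⟩, ?_⟩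
      · show (typI F₁ x.1, typI F₂ c) ∈ 𝒯
        rw [← hxc]; exact ht
      · show Sum.inl '' ERI F₁ x.1 ∪ Sum.inr '' ERI F₂ c ∈ 𝓔
        rw [← hxc]; exact hE
    · intro q hq
      rw [Finset.mem_filter, mem_QI] at hq
      obtain ⟨⟨hl, ht⟩, hE⟩ := hq
      rw [Finset.mem_filter, mem_QJ]
      exact ⟨⟨fun h => h.elim hl hc, ht⟩, rfl, hE⟩
    · intro x hx
      rw [Finset.mem_filter] at hx
      exact Prod.ext rfl hx.2.1.symm
    · intro q _
      rfl
  have e2 : ((QJ F₁ F₂ 𝒯).filter fun x => x.2 = c ∧ EMJ F₁ F₂ x ∈ 𝓔).card =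
      ((QI F₁ (sliceTJ₁ 𝒯 (typI F₂ c))).filter fun q => EBI F₁ q ∈ sliceEJ₁ 𝓔 (ERI F₂ c)).card := by
    refine Finset.card_bij' (fun x _ => x.1) (fun q _ => (q, c)) ?_ ?_ ?_ ?_
    · intro x hx
      rw [Finset.mem_filter, mem_QJ] at hx
      obtain ⟨⟨hl, ht⟩, hxc, hE⟩ := hx
      rw [Finset.mem_filter, mem_QI]
      refine ⟨⟨fun h => hl (Or.inl h), ?_⟩, ?_⟩
      · show (typI F₁ x.1, typI F₂ c) ∈ 𝒯
        rw [← hxc]; exact ht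
      · show Sum.inl '' EBI F₁ x.1 ∪ Sum.inr '' ERI F₂ c ∈ 𝓔
        rw [← hxc]; exact hE
    · intro q hq
      rw [Finset.mem_filter, mem_QI] at hq
      obtain ⟨⟨hl, ht⟩, hE⟩ := hq
      rw [Finset.mem_filter, mem_QJ]
      exact ⟨⟨fun h => h.elim hl hc, ht⟩, rfl, hE⟩
    · intro x hx
      rw [Finset.mem_filter] at hx
      exact Prod.ext rfl hx.2.1.symm
    · intro q _
      rfl
  rw [e1, e2]
  exact key

omit [DecidableEq W₂] in
/-- **Step 2, the first junction frozen**: the mixed count is at most the blue count. -/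
lemma card_mixed_le_blueJ (h₂ : Ineq F₂ (ι := ι₂)) {𝒯 : Set (TypJ L₁ ι₁ L₂ ι₂)}
    (h𝒯 : IsUpJ F₁ F₂ 𝒯) {𝓔 : Set (Set (AtomJ A₁ ι₁ A₂ ι₂))} (h𝓔 : IsUpperSet 𝓔)
    (q : PtG W₁ ι₁) :
    ((QJ F₁ F₂ 𝒯).filter fun x => x.1 = q ∧ EMJ F₁ F₂ x ∈ 𝓔).card ≤
      ((QJ F₁ F₂ 𝒯).filter fun x => x.1 = q ∧ EBJ F₁ F₂ x ∈ 𝓔).card := by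
  by_cases hq : LeakI F₁ q
  · have h0 : ∀ P : PtJ W₁ ι₁ W₂ ι₂ → Prop,
        ((QJ F₁ F₂ 𝒯).filter fun x => x.1 = q ∧ P x) = ∅ := by
      intro P
      rw [Finset.filter_eq_empty_iff]
      rintro x hx ⟨hxq, -⟩
      exact ((mem_QJ F₁ F₂).1 hx).1 (Or.inl (hxq ▸ hq))
    rw [h0, h0]
  have key := h₂ _ _ (isUpI_sliceTJ₂ F₁ F₂ h𝒯 (typI F₁ q)) (isUpperSet_sliceEJ₂ h𝓔 (EBI F₁ q))
  have e1 : ((QJ F₁ F₂ 𝒯).filter fun x => x.1 = q ∧ EMJ F₁ F₂ x ∈ 𝓔).card =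
      ((QI F₂ (sliceTJ₂ 𝒯 (typI F₁ q))).filter fun c => ERI F₂ c ∈ sliceEJ₂ 𝓔 (EBI F₁ q)).card := by
    refine Finset.card_bij' (fun x _ => x.2) (fun c _ => (q, c)) ?_ ?_ ?_ ?_
    · intro x hx
      rw [Finset.mem_filter, mem_QJ] at hx
      obtain ⟨⟨hl, ht⟩, hxq, hE⟩ := hx
      rw [Finset.mem_filter, mem_QI]
      refine ⟨⟨fun h => hl (Or.inr h), ?_⟩, ?_⟩
      · show (typI F₁ q, typI F₂ x.2) ∈ 𝒯
        rw [← hxq]; exact ht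
      · show Sum.inl '' EBI F₁ q ∪ Sum.inr '' ERI F₂ x.2 ∈ 𝓔
        rw [← hxq]; exact hE
    · intro c hc
      rw [Finset.mem_filter, mem_QI] at hc
      obtain ⟨⟨hl, ht⟩, hE⟩ := hc
      rw [Finset.mem_filter, mem_QJ]
      exact ⟨⟨fun h => h.elim hq hl, ht⟩, rfl, hE⟩
    · intro x hx
      rw [Finset.mem_filter] at hx
      exact Prod.ext hx.2.1.symm rfl
    · intro c _
      rfl
  have e2 : ((QJ F₁ F₂ 𝒯).filter fun x => x.1 = q ∧ EBJ F₁ F₂ x ∈ 𝓔).card =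
      ((QI F₂ (sliceTJ₂ 𝒯 (typI F₁ q))).filter fun c => EBI F₂ c ∈ sliceEJ₂ 𝓔 (EBI F₁ q)).card := by
    refine Finset.card_bij' (fun x _ => x.2) (fun c _ => (q, c)) ?_ ?_ ?_ ?_
    · intro x hx
      rw [Finset.mem_filter, mem_QJ] at hx
      obtain ⟨⟨hl, ht⟩, hxq, hE⟩ := hx
      rw [Finset.mem_filter, mem_QI]
      refine ⟨⟨fun h => hl (Or.inr h), ?_⟩, ?_⟩
      · show (typI F₁ q, typI F₂ x.2) ∈ 𝒯
        rw [← hxq]; exact ht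
      · show Sum.inl '' EBI F₁ q ∪ Sum.inr '' EBI F₂ x.2 ∈ 𝓔
        rw [← hxq]; exact hE
    · intro c hc
      rw [Finset.mem_filter, mem_QI] at hc
      obtain ⟨⟨hl, ht⟩, hE⟩ := hc
      rw [Finset.mem_filter, mem_QJ]
      exact ⟨⟨fun h => h.elim hq hl, ht⟩, rfl, hE⟩
    · intro x hx
      rw [Finset.mem_filter] at hx
      exact Prod.ext hx.2.1.symm rfl
    · intro c _
      rfl
  rw [e1, e2]
  exact key

omit [DecidableEq W₁] in
/-- A count over the product, fibred by the second junction. -/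
lemma card_fibre₂ {𝒯 : Set (TypJ L₁ ι₁ L₂ ι₂)} (P : PtJ W₁ ι₁ W₂ ι₂ → Prop) :
    ((QJ F₁ F₂ 𝒯).filter fun x => P x).card =
      ∑ c : PtG W₂ ι₂, ((QJ F₁ F₂ 𝒯).filter fun x => x.2 = c ∧ P x).card := by
  rw [Finset.card_eq_sum_card_fiberwise (f := fun x => x.2) (t := Finset.univ)
    (fun _ _ => Finset.mem_univ _)]
  refine Finset.sum_congr rfl fun c _ => ?_
  rw [Finset.filter_filter]
  congr 1
  exact Finset.filter_congr fun _ _ => and_comm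

omit [DecidableEq W₂] in
/-- A count over the product, fibred by the first junction. -/
lemma card_fibre₁ {𝒯 : Set (TypJ L₁ ι₁ L₂ ι₂)} (P : PtJ W₁ ι₁ W₂ ι₂ → Prop) :
    ((QJ F₁ F₂ 𝒯).filter fun x => P x).card =
      ∑ q : PtG W₁ ι₁, ((QJ F₁ F₂ 𝒯).filter fun x => x.1 = q ∧ P x).card := by
  rw [Finset.card_eq_sum_card_fiberwise (f := fun x => x.1) (t := Finset.univ)
    (fun _ _ => Finset.mem_univ _)]
  refine Finset.sum_congr rfl fun q _ => ?_
  rw [Finset.filter_filter]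
  congr 1
  exact Finset.filter_congr fun _ _ => and_comm

/-- **THE INEQUALITY OF THE PRODUCT OF TWO INDEPENDENT JUNCTIONS** from the inequalities of the
two factors. -/
theorem ineq_prodJ (h₁ : Ineq F₁ (ι := ι₁)) (h₂ : Ineq F₂ (ι := ι₂)) {𝒯 : Set (TypJ L₁ ι₁ L₂ ι₂)}
    (h𝒯 : IsUpJ F₁ F₂ 𝒯) {𝓔 : Set (Set (AtomJ A₁ ι₁ A₂ ι₂))} (h𝓔 : IsUpperSet 𝓔) :
    ((QJ F₁ F₂ 𝒯).filter fun x => ERJ F₁ F₂ x ∈ 𝓔).card ≤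
      ((QJ F₁ F₂ 𝒯).filter fun x => EBJ F₁ F₂ x ∈ 𝓔).card :=
  calc ((QJ F₁ F₂ 𝒯).filter fun x => ERJ F₁ F₂ x ∈ 𝓔).card
      = ∑ c : PtG W₂ ι₂, ((QJ F₁ F₂ 𝒯).filter fun x => x.2 = c ∧ ERJ F₁ F₂ x ∈ 𝓔).card :=
        card_fibre₂ F₁ F₂ _
    _ ≤ ∑ c : PtG W₂ ι₂, ((QJ F₁ F₂ 𝒯).filter fun x => x.2 = c ∧ EMJ F₁ F₂ x ∈ 𝓔).card :=
        Finset.sum_le_sum fun c _ => card_red_le_mixedJ F₁ F₂ h₁ h𝒯 h𝓔 c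
    _ = ((QJ F₁ F₂ 𝒯).filter fun x => EMJ F₁ F₂ x ∈ 𝓔).card := (card_fibre₂ F₁ F₂ _).symm
    _ = ∑ q : PtG W₁ ι₁, ((QJ F₁ F₂ 𝒯).filter fun x => x.1 = q ∧ EMJ F₁ F₂ x ∈ 𝓔).card :=
        card_fibre₁ F₁ F₂ _
    _ ≤ ∑ q : PtG W₁ ι₁, ((QJ F₁ F₂ 𝒯).filter fun x => x.1 = q ∧ EBJ F₁ F₂ x ∈ 𝓔).card :=
        Finset.sum_le_sum fun q _ => card_mixed_le_blueJ F₁ F₂ h₂ h𝒯 h𝓔 q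
    _ = ((QJ F₁ F₂ 𝒯).filter fun x => EBJ F₁ F₂ x ∈ 𝓔).card := (card_fibre₁ F₁ F₂ _).symm

end Junctions

end CrossArm

end Summit.Ventures.PercRepro2
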